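import Summits.Ventures.GridStability.Models.InverterNetworkVoltageLinearisation
import Summits.Ventures.GridStability.Models.RecastAngles
import Summits.Ventures.GridStability.Models.UniformDampingSpectrum

/-!
# GridStability/Models/DroopQVData — exact-rational instance data for the droop microgrid WITH Q–V voltage dynamics (A1-style operating point), the ℚ-twins of the Jacobian blocks, and the complex eigen-equation of `jacMatrix`

Cell `gridfusion` (LADDER-GRIDFUSION, APEX LINE rung G3.b; seat gridfusion-model-8 (g0); brief = gridfusion-lead
2026-08-27T08:25:47Z (ii), generic half). The analogue for model N1 (`DroopMicrogrid`, `Models/InverterNetwork.lean`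
p464230) of model-1's `RecastData` (PARTITION A1): a record `DroopQVData n` of EXACT RATIONAL instance data —
filter constants `τ_P, τ_Q`, droop gains `k_P, k_Q`, reduced network `G, B`, operating voltages `V*` (= the
nominal set-points `v⁰`), and rational unit-circle points `(s_i, c_i)` of the operating angles relative to unit
`0` — from which
* §1 `toMicrogrid` builds the real `DroopMicrogrid (n+1)` whose set-points are DEFINED from the operating point
  (`P^set_i := P_i(θ*, V*)`, `Q^set_i := Q_i(θ*, V*)`, `v⁰ := V*`; A1 «eq=b» style, so `(θ*, 0, V*)` is an exact
  rest point: `isSteadyState`, `field_eq_zero`), with `θ* = angleOf` (model-1's `RecastData.angleOf`,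
  `sin θ*_i = s_i`, `cos θ*_i = c_i`);
* §2 the ℚ-TWINS `gPQ, gQQ, dgPQ, aPQ, aQQ, PθQ, QθQ, PVQ, QVQ, PsetQ, QsetQ` of the power-flow sensitivities
  of `Models/InverterNetworkVoltageLinearisation.lean` at the operating point and the BRIDGES
  `Pθ_eq, Qθ_eq, PV_eq, QV_eq, Pset_eq, Qset_eq` (real block = rational matrix cast) — so an instance file
  evaluates the `3n × 3n` Jacobian EXACTLY by `decide` and a data seat compares literals;
* §0 (generic, any `DroopMicrogrid`) `jacMatrix_map_mulVec`: the complex eigen-equation of `jacMatrix (θ, V)`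
  row by row (angles / frequencies / voltages), the form point-certificate files consume.
THREE COLUMNS. CERTIFIED: nothing numeric (plumbing). MODELLED: whatever the instance declares (an A1-style
operating point makes the set-points a CONSTRUCTION unless they are printed). No parameter values here; no
sentence of this file says a converter or a microgrid is stable.
-/

noncomputable section

open Real Matrix Finset

namespace Summit.Ventures.GridStability.Models

namespace DroopMicrogrid

variable {n : ℕ} (mg : DroopMicrogrid n)

/-! ## §0 The complex eigen-equation of `jacMatrix` -/

/-- Plumbing: a negated real matrix acting on a complex vector. [folklore] -/
theorem map_ofReal_neg_mulVec {m : ℕ} (X : Matrix (Fin m) (Fin m) ℝ) (u : Fin m → ℂ) :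
    (-X).map ((↑) : ℝ → ℂ) *ᵥ u = -(X.map ((↑) : ℝ → ℂ) *ᵥ u) := by
  rw [Matrix.map_neg _ (fun a => Complex.ofReal_neg a), Matrix.neg_mulVec]

/-- Plumbing: `((diag d · X) u)_i = d_i (X u)_i` over `ℂ`. [folklore] -/
theorem map_ofReal_diagonal_mul_mulVec {m : ℕ} (dg : Fin m → ℝ) (X : Matrix (Fin m) (Fin m) ℝ) (u : Fin m → ℂ)
    (i : Fin m) : ((Matrix.diagonal dg * X).map ((↑) : ℝ → ℂ) *ᵥ u) i = (dg i : ℂ) * (X.map ((↑) : ℝ → ℂ) *ᵥ u) i := by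
  simp only [map_ofReal_mulVec_apply, Matrix.diagonal_mul, Finset.mul_sum]
  refine Finset.sum_congr rfl fun j _ => ?_
  push_cast; ring

/-- Plumbing: `((diag d) u)_i = d_i u_i` over `ℂ`. [folklore] -/
theorem map_ofReal_diagonal_mulVec {m : ℕ} (dg : Fin m → ℝ) (u : Fin m → ℂ) (i : Fin m) :
    ((Matrix.diagonal dg).map ((↑) : ℝ → ℂ) *ᵥ u) i = (dg i : ℂ) * u i := by
  rw [Matrix.diagonal_map (by simp), Matrix.mulVec_diagonal]

/-- Plumbing: `((1 + X) u)_i = u_i + (X u)_i` over `ℂ`. [folklore] -/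
theorem map_ofReal_one_add_mulVec {m : ℕ} (X : Matrix (Fin m) (Fin m) ℝ) (u : Fin m → ℂ) (i : Fin m) :
    ((1 + X).map ((↑) : ℝ → ℂ) *ᵥ u) i = u i + (X.map ((↑) : ℝ → ℂ) *ᵥ u) i := by
  rw [Matrix.map_add _ (fun a b => Complex.ofReal_add a b), Matrix.map_one _ Complex.ofReal_zero Complex.ofReal_one,
    Matrix.add_mulVec, Matrix.one_mulVec]
  rfl

/-- **`jacMatrix (θ, V)` acting on a complex vector `[u; w; e]`** (angles, frequencies, voltages), row by
row — the real lemma `jacMatrix_mulVec` read over `ℂ`, where the spectrum lives. [folklore] -/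
theorem jacMatrix_map_mulVec (θ V : Fin n → ℝ) (u w e : Fin n → ℂ) :
    (mg.jacMatrix θ V).map ((↑) : ℝ → ℂ) *ᵥ Sum.elim u (Sum.elim w e) =
      Sum.elim w (Sum.elim
        (fun i => -((mg.ΛP i : ℂ) * ((mg.Pθ θ V).map ((↑) : ℝ → ℂ) *ᵥ u) i) - w i / (mg.τP i : ℂ)
          - (mg.ΛP i : ℂ) * ((mg.PV θ V).map ((↑) : ℝ → ℂ) *ᵥ e) i)
        (fun i => -((mg.ΛQ i : ℂ) * ((mg.Qθ θ V).map ((↑) : ℝ → ℂ) *ᵥ u) i)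
          - (e i + (mg.kQ i : ℂ) * ((mg.QV θ V).map ((↑) : ℝ → ℂ) *ᵥ e) i) / (mg.τQ i : ℂ))) := by
  rw [jacMatrix, Matrix.fromBlocks_map, Matrix.fromCols_map, Matrix.fromRows_map, Matrix.fromBlocks_map,
    Matrix.map_zero _ Complex.ofReal_zero, Matrix.map_one _ Complex.ofReal_zero Complex.ofReal_one,
    Matrix.fromBlocks_mulVec, Matrix.fromBlocks_mulVec, Matrix.fromRows_mulVec, Matrix.fromCols_mulVec]
  simp only [Sum.elim_comp_inl, Sum.elim_comp_inr, Matrix.zero_mulVec, zero_add, add_zero, Matrix.one_mulVec]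
  funext k
  rcases k with i | i | i
  · simp
  · simp only [Sum.elim_inr, Sum.elim_inl, Pi.add_apply, map_ofReal_neg_mulVec, Pi.neg_apply,
      map_ofReal_diagonal_mul_mulVec, map_ofReal_diagonal_mulVec]
    push_cast
    ring
  · simp only [Sum.elim_inr, Pi.add_apply, map_ofReal_neg_mulVec, Pi.neg_apply, map_ofReal_diagonal_mul_mulVec,
      map_ofReal_one_add_mulVec]
    push_cast
    ring

end DroopMicrogrid

/-! ## §1 Exact instance data and the real model with set-points defined from the operating point -/

/-- Exact rational data of an `(n+1)`-unit droop microgrid WITH Q–V voltage dynamics about a rational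
operating point: filter time constants `τ_P, τ_Q`, droop gains `k_P, k_Q`, operating (= nominal) voltages
`V`, reduced network `G, B`, and the unit-circle points `(s_i, c_i) = (sin θ*_i, cos θ*_i)` of the operating
angles relative to unit `0` (intended `s 0 = 0`, `c 0 = 1`, `s_i² + c_i² = 1`). [folklore] -/
structure DroopQVData (n : ℕ) where
  /-- active-power filter time constants `τ_Pi` -/
  τP : Fin (n + 1) → ℚ
  /-- voltage filter time constants `τ_Qi` -/
  τQ : Fin (n + 1) → ℚ
  /-- P–ω droop gains `k_Pi` -/
  kP : Fin (n + 1) → ℚ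
  /-- Q–V droop gains `k_Qi` -/
  kQ : Fin (n + 1) → ℚ
  /-- operating voltage magnitudes `V*_i` (= nominal set-points `v⁰_i`) -/
  V : Fin (n + 1) → ℚ
  /-- reduced conductances `G_ij` -/
  G : Fin (n + 1) → Fin (n + 1) → ℚ
  /-- reduced susceptances `B_ij` -/
  B : Fin (n + 1) → Fin (n + 1) → ℚ
  /-- `sin θ*_i` -/
  s : Fin (n + 1) → ℚ
  /-- `cos θ*_i` -/
  c : Fin (n + 1) → ℚ

namespace DroopQVData

variable {n : ℕ} (d : DroopQVData n)

/-- The circle points read as model-1's `RecastData` (only `s, c` matter; used for `angleOf`). [folklore] -/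
def toRecast : RecastData n where
  M := fun _ => 1
  D := fun _ => 0
  E := d.V
  G := d.G
  B := d.B
  s := d.s
  c := d.c

/-- The operating angles `θ*_i` determined by the circle points (`RecastData.angleOf`). [folklore] -/
def angleOf : Fin (n + 1) → ℝ := d.toRecast.angleOf

/-- The operating voltages over `ℝ`. [folklore] -/
def Vstar : Fin (n + 1) → ℝ := fun i => (d.V i : ℝ)

/-- `sin θ*_i = s_i`. [folklore] -/
theorem sin_angleOf (hcirc : ∀ i, d.s i ^ 2 + d.c i ^ 2 = 1) (i : Fin (n + 1)) :
    sin (d.angleOf i) = (d.s i : ℝ) :=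
  d.toRecast.sin_angleOf (hcirc i)

/-- `cos θ*_i = c_i`. [folklore] -/
theorem cos_angleOf (hcirc : ∀ i, d.s i ^ 2 + d.c i ^ 2 = 1) (i : Fin (n + 1)) :
    cos (d.angleOf i) = (d.c i : ℝ) :=
  d.toRecast.cos_angleOf (hcirc i)

/-- The network and gains with DUMMY set-points (`P^set = Q^set = 0`, `v⁰ = V*`): the power flows `P`, `Q`
read only `G`, `B`. [folklore] -/
def net : DroopMicrogrid (n + 1) where
  τP i := d.τP i
  τQ i := d.τQ i
  kP i := d.kP i
  kQ i := d.kQ i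
  Pset := fun _ => 0
  Qset := fun _ => 0
  Vset i := d.V i
  G := fun i j => d.G i j
  B := fun i j => d.B i j

/-- **The real model instance `M′`**: the droop microgrid (4a)–(4c) with the rational data cast to `ℝ` and the
set-points DEFINED from the operating point — `P^set_i := P_i(θ*, V*)`, `Q^set_i := Q_i(θ*, V*)`, `v⁰_i := V*_i`
(A1 «eq=b» construction). [folklore] -/
def toMicrogrid : DroopMicrogrid (n + 1) :=
  { d.net with Pset := d.net.P d.angleOf d.Vstar, Qset := d.net.Q d.angleOf d.Vstar }

/-- The flows of `toMicrogrid` are those of `net` (they do not read the set-points). [folklore] -/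
theorem toMicrogrid_P : d.toMicrogrid.P = d.net.P := rfl

/-- Same for the reactive flows. [folklore] -/
theorem toMicrogrid_Q : d.toMicrogrid.Q = d.net.Q := rfl

/-- **`(θ*, 0, V*)` is the printed steady state of `M′`** (`P = P^set`, `Q = Q^set`, `ω = 0`, `V = v⁰`) — by
construction. [cite: KunduEtAl2019, after (5b)] -/
theorem isSteadyState : d.toMicrogrid.IsSteadyState d.angleOf := fun _ => ⟨rfl, rfl⟩

/-- **Exact rest point**: the field (4a)–(4c) of `M′` vanishes at `(θ*, 0, V*)`. [folklore] -/
theorem field_eq_zero : d.toMicrogrid.field (d.angleOf, 0, d.Vstar) = 0 :=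
  d.toMicrogrid.field_eq_zero_of_isSteadyState d.isSteadyState

/-! ## §2 The ℚ-twins of the sensitivities at the operating point and the bridges -/

/-- `sin(θ*_i − θ*_j) = s_i c_j − c_i s_j`, exact. [folklore] -/
def sdQ (i j : Fin (n + 1)) : ℚ := d.s i * d.c j - d.c i * d.s j

/-- `cos(θ*_i − θ*_j) = c_i c_j + s_i s_j`, exact. [folklore] -/
def cdQ (i j : Fin (n + 1)) : ℚ := d.c i * d.c j + d.s i * d.s j

/-- ℚ-twin of `gP`: `G_ij cos θ*_ij + B_ij sin θ*_ij`. [folklore] -/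
def gPQ (i j : Fin (n + 1)) : ℚ := d.G i j * d.cdQ i j + d.B i j * d.sdQ i j

/-- ℚ-twin of `gQ`: `G_ij sin θ*_ij − B_ij cos θ*_ij`. [folklore] -/
def gQQ (i j : Fin (n + 1)) : ℚ := d.G i j * d.sdQ i j - d.B i j * d.cdQ i j

/-- ℚ-twin of `dgP`: `−G_ij sin θ*_ij + B_ij cos θ*_ij`. [folklore] -/
def dgPQ (i j : Fin (n + 1)) : ℚ := -(d.G i j * d.sdQ i j) + d.B i j * d.cdQ i j

/-- ℚ-twin of `aP`. [folklore] -/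
def aPQ : Matrix (Fin (n + 1)) (Fin (n + 1)) ℚ := fun i j => d.V i * d.V j * d.dgPQ i j

/-- ℚ-twin of `aQ`. [folklore] -/
def aQQ : Matrix (Fin (n + 1)) (Fin (n + 1)) ℚ := fun i j => d.V i * d.V j * d.gPQ i j

/-- ℚ-twin of `Pθ = ∂P/∂θ` at the operating point (diagonal as a kernel-friendly `List` sum). [folklore] -/
def PθQ : Matrix (Fin (n + 1)) (Fin (n + 1)) ℚ := fun i j =>
  (if j = i then ((List.finRange (n + 1)).map (d.aPQ i)).sum else 0) - d.aPQ i j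

/-- ℚ-twin of `Qθ = ∂Q/∂θ`. [folklore] -/
def QθQ : Matrix (Fin (n + 1)) (Fin (n + 1)) ℚ := fun i j =>
  (if j = i then ((List.finRange (n + 1)).map (d.aQQ i)).sum else 0) - d.aQQ i j

/-- ℚ-twin of `PV = ∂P/∂V`. [folklore] -/
def PVQ : Matrix (Fin (n + 1)) (Fin (n + 1)) ℚ := fun i j =>
  (if j = i then ((List.finRange (n + 1)).map (fun k => d.V k * d.gPQ i k)).sum else 0) + d.V i * d.gPQ i j

/-- ℚ-twin of `QV = ∂Q/∂V`. [folklore] -/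
def QVQ : Matrix (Fin (n + 1)) (Fin (n + 1)) ℚ := fun i j =>
  (if j = i then ((List.finRange (n + 1)).map (fun k => d.V k * d.gQQ i k)).sum else 0) + d.V i * d.gQQ i j

/-- ℚ-twin of the defined set-point `P^set_i = P_i(θ*, V*)`. [folklore] -/
def PsetQ (i : Fin (n + 1)) : ℚ := ((List.finRange (n + 1)).map (fun j => d.V i * d.V j * d.gPQ i j)).sum

/-- ℚ-twin of `Q^set_i = Q_i(θ*, V*)`. [folklore] -/
def QsetQ (i : Fin (n + 1)) : ℚ := ((List.finRange (n + 1)).map (fun j => d.V i * d.V j * d.gQQ i j)).sum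

/-- `List` sums over `finRange` are `Finset` sums (kernel-friendly ↔ `Finset` API). [folklore] -/
theorem list_sum_finRange (f : Fin (n + 1) → ℚ) : ((List.finRange (n + 1)).map f).sum = ∑ j, f j := by
  rw [← List.sum_toFinset _ (List.nodup_finRange _)]
  simp

variable (hcirc : ∀ i, d.s i ^ 2 + d.c i ^ 2 = 1)
include hcirc

/-- Bridge for `sin θ*_ij`. [folklore] -/
theorem sin_sub_angleOf (i j : Fin (n + 1)) : sin (d.angleOf i - d.angleOf j) = (d.sdQ i j : ℝ) := by
  rw [sin_sub, d.sin_angleOf hcirc, d.cos_angleOf hcirc, d.sin_angleOf hcirc, d.cos_angleOf hcirc, sdQ]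
  push_cast; ring

/-- Bridge for `cos θ*_ij`. [folklore] -/
theorem cos_sub_angleOf (i j : Fin (n + 1)) : cos (d.angleOf i - d.angleOf j) = (d.cdQ i j : ℝ) := by
  rw [cos_sub, d.cos_angleOf hcirc, d.cos_angleOf hcirc, d.sin_angleOf hcirc, d.sin_angleOf hcirc, cdQ]
  push_cast; ring

/-- Bridge for `gP`. [folklore] -/
theorem gP_eq (i j : Fin (n + 1)) : d.toMicrogrid.gP d.angleOf i j = (d.gPQ i j : ℝ) := by
  simp only [DroopMicrogrid.gP, toMicrogrid, net, d.sin_sub_angleOf hcirc, d.cos_sub_angleOf hcirc, gPQ]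
  push_cast; ring

/-- Bridge for `gQ`. [folklore] -/
theorem gQ_eq (i j : Fin (n + 1)) : d.toMicrogrid.gQ d.angleOf i j = (d.gQQ i j : ℝ) := by
  simp only [DroopMicrogrid.gQ, toMicrogrid, net, d.sin_sub_angleOf hcirc, d.cos_sub_angleOf hcirc, gQQ]
  push_cast; ring

/-- Bridge for `dgP`. [folklore] -/
theorem dgP_eq (i j : Fin (n + 1)) : d.toMicrogrid.dgP d.angleOf i j = (d.dgPQ i j : ℝ) := by
  simp only [DroopMicrogrid.dgP, toMicrogrid, net, d.sin_sub_angleOf hcirc, d.cos_sub_angleOf hcirc, dgPQ]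
  push_cast; ring

/-- **Bridge for `Pθ`**: the real block at `(θ*, V*)` IS `PθQ` cast. [folklore] -/
theorem Pθ_eq : d.toMicrogrid.Pθ d.angleOf d.Vstar = d.PθQ.map ((↑) : ℚ → ℝ) := by
  ext i j
  simp only [DroopMicrogrid.Pθ, DroopMicrogrid.aP, Matrix.sub_apply, Matrix.diagonal_apply, Matrix.map_apply,
    PθQ, aPQ, list_sum_finRange, d.dgP_eq hcirc, Vstar]
  by_cases h : i = j
  · subst h
    simp only [if_true]
    push_cast
    ring
  · have h' : ¬ j = i := fun e => h e.symm
    simp only [h, h', if_false]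
    push_cast
    ring

/-- **Bridge for `Qθ`.** [folklore] -/
theorem Qθ_eq : d.toMicrogrid.Qθ d.angleOf d.Vstar = d.QθQ.map ((↑) : ℚ → ℝ) := by
  ext i j
  simp only [DroopMicrogrid.Qθ, DroopMicrogrid.aQ, Matrix.sub_apply, Matrix.diagonal_apply, Matrix.map_apply,
    QθQ, aQQ, list_sum_finRange, d.gP_eq hcirc, Vstar]
  by_cases h : i = j
  · subst h
    simp only [if_true]
    push_cast
    ring
  · have h' : ¬ j = i := fun e => h e.symm
    simp only [h, h', if_false]
    push_cast
    ring

/-- **Bridge for `PV`.** [folklore] -/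
theorem PV_eq : d.toMicrogrid.PV d.angleOf d.Vstar = d.PVQ.map ((↑) : ℚ → ℝ) := by
  ext i j
  simp only [DroopMicrogrid.PV, Matrix.add_apply, Matrix.diagonal_apply, Matrix.of_apply, Matrix.map_apply,
    PVQ, list_sum_finRange, d.gP_eq hcirc, Vstar]
  by_cases h : i = j
  · subst h
    simp only [if_true]
    push_cast
    ring
  · have h' : ¬ j = i := fun e => h e.symm
    simp only [h, h', if_false]
    push_cast
    ring

/-- **Bridge for `QV`.** [folklore] -/
theorem QV_eq : d.toMicrogrid.QV d.angleOf d.Vstar = d.QVQ.map ((↑) : ℚ → ℝ) := by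
  ext i j
  simp only [DroopMicrogrid.QV, Matrix.add_apply, Matrix.diagonal_apply, Matrix.of_apply, Matrix.map_apply,
    QVQ, list_sum_finRange, d.gQ_eq hcirc, Vstar]
  by_cases h : i = j
  · subst h
    simp only [if_true]
    push_cast
    ring
  · have h' : ¬ j = i := fun e => h e.symm
    simp only [h, h', if_false]
    push_cast
    ring

/-- **Bridge for the defined set-point `P^set`**: `P^set_i = PsetQ i` cast. [folklore] -/
theorem Pset_eq (i : Fin (n + 1)) : d.toMicrogrid.Pset i = (d.PsetQ i : ℝ) := by
  change d.net.P d.angleOf d.Vstar i = _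
  simp only [DroopMicrogrid.P, PsetQ, list_sum_finRange, Vstar]
  push_cast
  refine Finset.sum_congr rfl fun j _ => ?_
  rw [← d.gP_eq hcirc]
  simp only [DroopMicrogrid.gP, toMicrogrid, net]

/-- **Bridge for `Q^set`.** [folklore] -/
theorem Qset_eq (i : Fin (n + 1)) : d.toMicrogrid.Qset i = (d.QsetQ i : ℝ) := by
  change d.net.Q d.angleOf d.Vstar i = _
  simp only [DroopMicrogrid.Q, QsetQ, list_sum_finRange, Vstar]
  push_cast
  refine Finset.sum_congr rfl fun j _ => ?_
  rw [← d.gQ_eq hcirc]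
  simp only [DroopMicrogrid.gQ, toMicrogrid, net]

omit hcirc in
/-- The gains and time constants of `M′` are the rational data (cast). [folklore] -/
theorem toMicrogrid_gains (i : Fin (n + 1)) :
    d.toMicrogrid.τP i = (d.τP i : ℝ) ∧ d.toMicrogrid.τQ i = (d.τQ i : ℝ) ∧ d.toMicrogrid.kP i = (d.kP i : ℝ) ∧
      d.toMicrogrid.kQ i = (d.kQ i : ℝ) ∧ d.toMicrogrid.ΛP i = ((d.kP i / d.τP i : ℚ) : ℝ) ∧
      d.toMicrogrid.ΛQ i = ((d.kQ i / d.τQ i : ℚ) : ℝ) := by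
  refine ⟨rfl, rfl, rfl, rfl, ?_, ?_⟩ <;> simp [DroopMicrogrid.ΛP, DroopMicrogrid.ΛQ, toMicrogrid, net]

/-! ### (append 2026-08-27, model-8 g0) The ℚ-twin of the full `3n × 3n` Jacobian at the operating point -/

/-- ℚ-twin of `jacMatrix (θ*, V*)` (same block layout as `DroopMicrogrid.jacMatrix`). [folklore] -/
def jacQ : Matrix (Fin (n + 1) ⊕ (Fin (n + 1) ⊕ Fin (n + 1))) (Fin (n + 1) ⊕ (Fin (n + 1) ⊕ Fin (n + 1))) ℚ :=
  Matrix.fromBlocks 0 (Matrix.fromCols 1 0)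
    (Matrix.fromRows (-(Matrix.diagonal (fun i => d.kP i / d.τP i) * d.PθQ))
      (-(Matrix.diagonal (fun i => d.kQ i / d.τQ i) * d.QθQ)))
    (Matrix.fromBlocks (-Matrix.diagonal fun i => 1 / d.τP i) (-(Matrix.diagonal (fun i => d.kP i / d.τP i) * d.PVQ))
      0 (-(Matrix.diagonal (fun i => 1 / d.τQ i) * (1 + Matrix.diagonal d.kQ * d.QVQ))))

/-- **Bridge for the full Jacobian**: `jacMatrix (θ*, V*)` of `M′` IS `jacQ` cast to `ℝ` (entrywise over the nine blocks). [folklore] -/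
theorem jacMatrix_eq : d.toMicrogrid.jacMatrix d.angleOf d.Vstar = d.jacQ.map ((↑) : ℚ → ℝ) := by
  have hg := fun i => d.toMicrogrid_gains i
  rw [DroopMicrogrid.jacMatrix, d.Pθ_eq hcirc, d.PV_eq hcirc, d.Qθ_eq hcirc, d.QV_eq hcirc, jacQ]
  ext (i | i | i) (j | j | j) <;>
    simp [Matrix.fromBlocks, Matrix.fromCols, Matrix.fromRows, Matrix.mul_apply,
      Matrix.one_apply, Matrix.diagonal_apply, apply_ite ((↑) : ℚ → ℝ), DroopMicrogrid.ΛP, DroopMicrogrid.ΛQ,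
      (hg i).1, (hg i).2.1, (hg i).2.2.1, (hg i).2.2.2.1]

end DroopQVData

end Summit.Ventures.GridStability.Models

end
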